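import Mathlib.MeasureTheory.Measure.Lebesgue.Complex
import Mathlib.MeasureTheory.Measure.Haar.InnerProductSpace
import Mathlib.Analysis.Complex.Isometry
import Mathlib.Analysis.Complex.Circle
import Literature.Geometry.MetricEmbeddings.HeisenbergKoranyiLines
import HarnessLib

/-!
# Horizontal lines of `ℍ`, their invariant measure, monotone sets and half-spaces

Family `pnp`, layer `Literature/Geometry/MetricEmbeddings`. The vocabulary of [CKN] §2 ("The
Heisenberg group as a PI space"; "A subset `E ⊂ ℍ` is called monotone if for every horizontal line
`L`, up to a set of measure zero, `E ∩ L` is a sub-ray of the line. If we view `ℍ = ℝ³`, the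
horizontal lines are a certain codimension `1` subset of all the lines"; "a non-trivial
classification theorem which asserts that monotone subsets are half spaces") and §4 ("Let
`lines(ℍ)` denote the space of unparameterized oriented horizontal lines […] Let `𝒩` denote the
unique left-invariant measure on `lines(ℍ)` […] `ℋ¹_L` denote `1`-dimensional Hausdorff measure on
`L ∈ lines(ℍ)`"), on the model `HeisK` of `HeisenbergKoranyi.lean` (law
`(x,y,z)(x',y',z') = (x+x', y+y', z+z'+xy')`, Cygan–Korányi metric `d_K`, Haar measure
`volume = dx dy dz`). Source: J. Cheeger, B. Kleiner, A. Naor, arXiv:0910.2026 = Acta Math. 207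
(2011), §§1.1, 2, 4 (arXiv pp. 4–5, 7–8, 13–14).

DEFINED here (real definitions, with the API listed):

* `HeisK.ckn : HeisK → ℝ³`, `HeisK.ofCKN`, `HeisK.cknEquiv` — the coordinates
  `(a,b,c) = (x, y, 2z − xy)` of [CKN §1.1]; `ckn_mul` shows that in them the product IS
  `(a+a', b+b', c+c'+ab'−ba')`, i.e. `HeisK` is literally the group of the paper
  (`ckn_inv`, `ckn_dilate`: `A_R(a,b,c) = (Ra,Rb,R²c)`, `quartic_eq_ckn`);
* `HeisK.horizontal θ t = (t cos θ, t sin θ, cos θ sin θ t²/2)` — the horizontal one-parameter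
  subgroups (`ckn_horizontal`: `(t cos θ, t sin θ, 0)`; `horizontal_add`, `horizontal_neg`,
  `dilate_horizontal'`; `dist_mul_horizontal`: their left cosets, the HORIZONTAL LINES, are
  unit-speed geodesics of `d_K`);
* `HeisK.transversal θ s w`, `HeisK.lineMap θ ((s,w),t) = transversal θ s w · horizontal θ t` and
  its inverse `HeisK.lineParam`, `HeisK.lineEquiv θ : ℝ³ ≃ ℍ` — for each direction `θ` the oriented
  horizontal lines of direction `θ` are `{Λ_θ((s,w),·)}`, parametrised bijectively by
  `(s,w) ∈ ℝ²` with arc-length parameter `t` (`dist_lineMap`); `ckn_lineMap`: in the coordinates of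
  [CKN] they are the straight lines `(−s sin θ, s cos θ, c₀) + t(cos θ, sin θ, −s)`;
  `mul_lineMap`, `dilate_lineMap`: left translations and dilations permute the lines of each
  direction, acting on `(s, w)` by unimodular affine maps / by `(rs, r²w)` and on `t` by a
  translation / by `rt`;
* `HeisK.IsRay`, `HeisK.IsEssRay` (a subset of `ℝ` a.e. equal to `∅`, `ℝ` or a half-line) and
  **`HeisK.IsMonotone E`**: for Lebesgue-a.e. `(θ, s, w)` the slice `{t | Λ_θ((s,w),t) ∈ E}` is
  essentially a ray — the monotone sets of [CKN §2] (the `𝒩`-null sets of lines being the null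
  sets of parameters, see below);
* `HeisK.halfspace α β γ c₀ = {α a + β b + γ c < c₀}` in the coordinates of [CKN] (vertical
  half-spaces: `γ = 0`).

PROVED here (no named facts):

* `HeisK.measurePreserving_lineMap`: **`Λ_θ : (ℝ³, ds dw dt) → (ℍ, L₃)` is measure preserving**
  (a shear and a planar rotation; `measurePreserving_rotate` via `ℂ`), whence
  `HeisK.volume_eq_lintegral_lines` — **Cavalieri along horizontal lines**:
  `L₃(E) = ∫∫ ℋ¹{t | Λ_θ((s,w),t) ∈ E} ds dw` for every direction `θ`;
* `HeisK.measurePreserving_lineParamShift`: the action of left translations on the parameters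
  `(θ, s, w)` preserves `dθ ds dw` — **the measure on lines is left-invariant** (it is the measure
  `𝒩` of [CKN §4] up to normalisation); `HeisK.quasiMeasurePreserving_lineParamDilate`;
* `HeisK.IsMonotone.compl`, `.preimage_mul_left`, `.preimage_dilate`: monotonicity is preserved by
  complements, left translations and dilations;
* `HeisK.isMonotone_halfspace` (and `isRay_halfspace_slice`: EVERY horizontal line meets a
  half-space in a ray) — the easy direction of the classification of monotone sets [CKN §8];
  `isOpen_halfspace`, `preimage_mul_halfspace`, `preimage_dilate_halfspace` (the family of
  half-spaces is invariant).

NOT here: the hard direction of the classification (monotone ⇒ a.e. a half-space, [CKN §8] after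
Cheeger–Kleiner), the nonconvexity/nonmonotonicity functionals `NC`, `NM` and `δ`-monotone sets
([CKN §4 Def. 18]), the kinematic formula for the perimeter ([CKN §6]), the normalisation
`𝒩(lines(B_1)) = 1`.

## References

* [CheegerKleinerNaor2011] J. Cheeger, B. Kleiner, A. Naor, Acta Math. 207 (2011) 291–373, §§1.1,
  2, 4 (arXiv:0910.2026 pp. 4–5, 7–8, 13–14).
* [Cygan1981] J. Cygan, Proc. AMS 83 (1981) 69–70.
-/

noncomputable section

open MeasureTheory Set Real

namespace Literature.Geometry.MetricEmbeddings

namespace HeisK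

/-! ### The coordinates of [CKN] -/

/-- The coordinates `(a, b, c) = (x, y, 2z − xy)` of [CKN §1.1] ("We will view `ℍ` as `ℝ³`
equipped with the noncommutative product `(a,b,c)·(a',b',c') = (a+a', b+b', c+c'+ab'−ba')`"):
in them the law of `HeisK` becomes exactly this product (`ckn_mul`).
[cite: CheegerKleinerNaor2011, §1.1] -/
def ckn (p : HeisK) : ℝ × ℝ × ℝ := (p.x, p.y, 2 * p.z - p.x * p.y)

/-- [cite: CheegerKleinerNaor2011, §1.1] -/
@[simp] theorem ckn_fst (p : HeisK) : (ckn p).1 = p.x := rfl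
/-- [cite: CheegerKleinerNaor2011, §1.1] -/
@[simp] theorem ckn_snd_fst (p : HeisK) : (ckn p).2.1 = p.y := rfl
/-- [cite: CheegerKleinerNaor2011, §1.1] -/
@[simp] theorem ckn_snd_snd (p : HeisK) : (ckn p).2.2 = 2 * p.z - p.x * p.y := rfl

/-- The inverse coordinate map `(a, b, c) ↦ (a, b, (c + ab)/2)`. [cite: CheegerKleinerNaor2011, §1.1] -/
def ofCKN (v : ℝ × ℝ × ℝ) : HeisK := mk v.1 v.2.1 ((v.2.2 + v.1 * v.2.1) / 2)

/-- [cite: CheegerKleinerNaor2011, §1.1] -/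
@[simp] theorem ofCKN_ckn (p : HeisK) : ofCKN (ckn p) = p := by
  ext <;> simp [ofCKN, ckn]

/-- [cite: CheegerKleinerNaor2011, §1.1] -/
@[simp] theorem ckn_ofCKN (v : ℝ × ℝ × ℝ) : ckn (ofCKN v) = v := by
  obtain ⟨a, b, c⟩ := v
  simp only [ckn, ofCKN, mk_x, mk_y, mk_z, Prod.mk.injEq]
  exact ⟨trivial, trivial, by ring⟩

/-- `HeisK ≃ ℝ³` via the coordinates of [CKN]. [cite: CheegerKleinerNaor2011, §1.1] -/
def cknEquiv : HeisK ≃ ℝ × ℝ × ℝ where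
  toFun := ckn
  invFun := ofCKN
  left_inv := ofCKN_ckn
  right_inv := ckn_ofCKN

/-- **`HeisK` is the Heisenberg group of [CKN]**: in the coordinates `(a,b,c) = (x, y, 2z − xy)`
the product is `(a+a', b+b', c+c'+ab'−ba')`. [cite: CheegerKleinerNaor2011, §1.1] -/
theorem ckn_mul (p q : HeisK) :
    ckn (p * q) = ((ckn p).1 + (ckn q).1, (ckn p).2.1 + (ckn q).2.1,
      (ckn p).2.2 + (ckn q).2.2 + ((ckn p).1 * (ckn q).2.1 - (ckn p).2.1 * (ckn q).1)) := by
  simp only [ckn, mul_x, mul_y, mul_z, Prod.mk.injEq]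
  exact ⟨trivial, trivial, by ring⟩

/-- [cite: CheegerKleinerNaor2011, §1.1] -/
@[simp] theorem ckn_one : ckn 1 = (0, 0, 0) := by
  simp [ckn]

/-- Inversion is `(a,b,c) ↦ (−a,−b,−c)` in the coordinates of [CKN]. [cite: CheegerKleinerNaor2011, §1.1] -/
theorem ckn_inv (p : HeisK) : ckn p⁻¹ = (-(ckn p).1, -(ckn p).2.1, -(ckn p).2.2) := by
  simp only [ckn, inv_x, inv_y, inv_z, Prod.mk.injEq]
  exact ⟨trivial, trivial, by ring⟩

/-- The dilations are `A_R(a,b,c) = (Ra, Rb, R²c)` in the coordinates of [CKN].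
[cite: CheegerKleinerNaor2011, §1.1] -/
theorem ckn_dilate (r : ℝ) (p : HeisK) :
    ckn (dilate r p) = (r * (ckn p).1, r * (ckn p).2.1, r ^ 2 * (ckn p).2.2) := by
  simp only [ckn, dilate_x, dilate_y, dilate_z, Prod.mk.injEq]
  exact ⟨trivial, trivial, by ring⟩

/-- The Cygan–Korányi quartic in the coordinates of [CKN]: `Q(p) = (a² + b²)² + 4c²`
(`c = 2z − xy`). [cite: Cygan1981, p. 69] -/
theorem quartic_eq_ckn (p : HeisK) :
    quartic p = ((ckn p).1 ^ 2 + (ckn p).2.1 ^ 2) ^ 2 + 4 * (ckn p).2.2 ^ 2 := by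
  simp only [quartic, ckn]

/-! ### Horizontal lines: the one-parameter subgroups and their left cosets -/

/-- The **horizontal one-parameter subgroup** with direction angle `θ`:
`γ_θ(t) = (t cos θ, t sin θ, cos θ sin θ · t²/2)`, i.e. `(t cos θ, t sin θ, 0)` in the coordinates
of [CKN] (`ckn_horizontal`). [cite: CheegerKleinerNaor2011, §2 (arXiv p. 8)] -/
def horizontal (θ t : ℝ) : HeisK :=
  mk (t * Real.cos θ) (t * Real.sin θ) (Real.cos θ * Real.sin θ * t ^ 2 / 2)

/-- [cite: CheegerKleinerNaor2011, §2 (arXiv p. 8)] -/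
@[simp] theorem horizontal_x (θ t : ℝ) : (horizontal θ t).x = t * Real.cos θ := rfl
/-- [cite: CheegerKleinerNaor2011, §2 (arXiv p. 8)] -/
@[simp] theorem horizontal_y (θ t : ℝ) : (horizontal θ t).y = t * Real.sin θ := rfl
/-- [cite: CheegerKleinerNaor2011, §2 (arXiv p. 8)] -/
@[simp] theorem horizontal_z (θ t : ℝ) :
    (horizontal θ t).z = Real.cos θ * Real.sin θ * t ^ 2 / 2 := rfl

/-- In the coordinates of [CKN] the horizontal subgroups are the lines `t(cos θ, sin θ, 0)`.
[cite: CheegerKleinerNaor2011, §2 (arXiv p. 8)] -/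
theorem ckn_horizontal (θ t : ℝ) : ckn (horizontal θ t) = (t * Real.cos θ, t * Real.sin θ, 0) := by
  simp only [ckn, horizontal_x, horizontal_y, horizontal_z, Prod.mk.injEq]
  exact ⟨trivial, trivial, by ring⟩

/-- `γ_θ` is a one-parameter subgroup: `γ_θ(s + t) = γ_θ(s) γ_θ(t)`.
[cite: CheegerKleinerNaor2011, §2 (arXiv p. 8)] -/
theorem horizontal_add (θ s t : ℝ) : horizontal θ (s + t) = horizontal θ s * horizontal θ t := by
  rw [horizontal, horizontal, horizontal, horizontal_mul]

/-- [cite: CheegerKleinerNaor2011, §2 (arXiv p. 8)] -/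
@[simp] theorem horizontal_at_zero (θ : ℝ) : horizontal θ 0 = 1 := by
  ext <;> simp

/-- [cite: CheegerKleinerNaor2011, §2 (arXiv p. 8)] -/
theorem horizontal_neg (θ t : ℝ) : horizontal θ (-t) = (horizontal θ t)⁻¹ := by
  rw [eq_inv_iff_mul_eq_one, ← horizontal_add, neg_add_cancel, horizontal_at_zero]

/-- `γ_θ(t) = δ_t γ_θ(1)`. [cite: CheegerKleinerNaor2011, §1.1] -/
theorem horizontal_eq_dilate' (θ t : ℝ) : horizontal θ t = dilate t (horizontal θ 1) := by
  ext
  · simp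
  · simp
  · simp only [horizontal_z, dilate_z]
    ring

/-- `δ_r γ_θ(t) = γ_θ(rt)`. [cite: CheegerKleinerNaor2011, §1.1] -/
theorem dilate_horizontal' (r θ t : ℝ) : dilate r (horizontal θ t) = horizontal θ (r * t) := by
  rw [horizontal, dilate_horizontal, horizontal]

/-- **Horizontal lines are unit-speed geodesics**: `d_K(p γ_θ(s), p γ_θ(t)) = |s − t|`.
[cite: CheegerKleinerNaor2011, §2 (arXiv p. 8)] -/
theorem dist_mul_horizontal (p : HeisK) (θ s t : ℝ) :
    dist (p * horizontal θ s) (p * horizontal θ t) = |s - t| :=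
  dist_horizontal p (by rw [Real.cos_sq_add_sin_sq]) s t

/-- The **transversal** to the direction `θ`: the point `(−s sin θ, s cos θ, w)`; every horizontal
line of direction `θ` is `{q_θ(s,w) γ_θ(t)}` for exactly one `(s, w)` (the parameter `t = 0`
being the point whose horizontal projection is orthogonal to the direction).
[cite: CheegerKleinerNaor2011, §4 (arXiv p. 13)] -/
def transversal (θ s w : ℝ) : HeisK := mk (-s * Real.sin θ) (s * Real.cos θ) w

/-- [cite: CheegerKleinerNaor2011, §4 (arXiv p. 13)] -/
@[simp] theorem transversal_x (θ s w : ℝ) : (transversal θ s w).x = -s * Real.sin θ := rfl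
/-- [cite: CheegerKleinerNaor2011, §4 (arXiv p. 13)] -/
@[simp] theorem transversal_y (θ s w : ℝ) : (transversal θ s w).y = s * Real.cos θ := rfl
/-- [cite: CheegerKleinerNaor2011, §4 (arXiv p. 13)] -/
@[simp] theorem transversal_z (θ s w : ℝ) : (transversal θ s w).z = w := rfl

/-- The **parametrisation of the oriented horizontal lines of direction `θ`**:
`Λ_θ((s, w), t) = q_θ(s,w) · γ_θ(t)`; for fixed `(s, w)` this is the unit-speed horizontal line
through the transversal point `q_θ(s,w)`, and `((s,w),t) ↦ Λ_θ((s,w),t)` is a bijection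
`ℝ³ → ℍ` (`lineMap_injective`, `lineMap_surjective`) — the space `lines(ℍ)` of [CKN §4] is
thereby `{θ} × {(s,w)}`. [cite: CheegerKleinerNaor2011, §4 (arXiv p. 13)] -/
def lineMap (θ : ℝ) (v : (ℝ × ℝ) × ℝ) : HeisK := transversal θ v.1.1 v.1.2 * horizontal θ v.2

/-- Coordinates along a horizontal line. [cite: CheegerKleinerNaor2011, §4 (arXiv p. 13)] -/
theorem lineMap_x (θ s w t : ℝ) :
    (lineMap θ ((s, w), t)).x = -s * Real.sin θ + t * Real.cos θ := by
  simp [lineMap]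

/-- [cite: CheegerKleinerNaor2011, §4 (arXiv p. 13)] -/
theorem lineMap_y (θ s w t : ℝ) :
    (lineMap θ ((s, w), t)).y = s * Real.cos θ + t * Real.sin θ := by
  simp [lineMap]

/-- [cite: CheegerKleinerNaor2011, §4 (arXiv p. 13)] -/
theorem lineMap_z (θ s w t : ℝ) :
    (lineMap θ ((s, w), t)).z =
      w + Real.cos θ * Real.sin θ * t ^ 2 / 2 - s * t * Real.sin θ ^ 2 := by
  simp [lineMap]; ring

/-- **In the coordinates of [CKN], horizontal lines are straight lines**: along `Λ_θ((s,w),·)`,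
`(a, b, c) = (−s sin θ, s cos θ, 2w + s² sin θ cos θ) + t (cos θ, sin θ, −s)`.
[cite: CheegerKleinerNaor2011, §2 (arXiv p. 8)] -/
theorem ckn_lineMap (θ s w t : ℝ) :
    ckn (lineMap θ ((s, w), t)) =
      (-s * Real.sin θ + t * Real.cos θ, s * Real.cos θ + t * Real.sin θ,
        (2 * w + s ^ 2 * Real.sin θ * Real.cos θ) - s * t) := by
  simp only [ckn, lineMap_x, lineMap_y, lineMap_z, Prod.mk.injEq]
  refine ⟨trivial, trivial, ?_⟩
  have h := Real.sin_sq_add_cos_sq θ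
  linear_combination (-(s * t)) * h

/-- Recovering the parameters from a point: `t = x cos θ + y sin θ`, `s = −x sin θ + y cos θ`.
[cite: CheegerKleinerNaor2011, §4 (arXiv p. 13)] -/
theorem lineMap_param_t (θ s w t : ℝ) :
    (lineMap θ ((s, w), t)).x * Real.cos θ + (lineMap θ ((s, w), t)).y * Real.sin θ = t := by
  rw [lineMap_x, lineMap_y]
  have h := Real.sin_sq_add_cos_sq θ
  linear_combination t * h

/-- [cite: CheegerKleinerNaor2011, §4 (arXiv p. 13)] -/
theorem lineMap_param_s (θ s w t : ℝ) :
    -(lineMap θ ((s, w), t)).x * Real.sin θ + (lineMap θ ((s, w), t)).y * Real.cos θ = s := by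
  rw [lineMap_x, lineMap_y]
  have h := Real.sin_sq_add_cos_sq θ
  linear_combination s * h

/-- The inverse parametrisation: `p ↦ ((s, w), t)`. [cite: CheegerKleinerNaor2011, §4 (arXiv p. 13)] -/
def lineParam (θ : ℝ) (p : HeisK) : (ℝ × ℝ) × ℝ :=
  ((-p.x * Real.sin θ + p.y * Real.cos θ,
    p.z - Real.cos θ * Real.sin θ * (p.x * Real.cos θ + p.y * Real.sin θ) ^ 2 / 2 +
      (-p.x * Real.sin θ + p.y * Real.cos θ) * (p.x * Real.cos θ + p.y * Real.sin θ) *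
        Real.sin θ ^ 2),
    p.x * Real.cos θ + p.y * Real.sin θ)

/-- [cite: CheegerKleinerNaor2011, §4 (arXiv p. 13)] -/
theorem lineParam_lineMap (θ : ℝ) (v : (ℝ × ℝ) × ℝ) : lineParam θ (lineMap θ v) = v := by
  obtain ⟨⟨s, w⟩, t⟩ := v
  have ht := lineMap_param_t θ s w t
  have hs := lineMap_param_s θ s w t
  simp only [lineParam, Prod.mk.injEq]
  refine ⟨⟨hs, ?_⟩, ht⟩
  rw [ht, hs, lineMap_z]
  ring

/-- [cite: CheegerKleinerNaor2011, §4 (arXiv p. 13)] -/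
theorem lineMap_lineParam (θ : ℝ) (p : HeisK) : lineMap θ (lineParam θ p) = p := by
  have h := Real.sin_sq_add_cos_sq θ
  ext
  · rw [show lineParam θ p = ((lineParam θ p).1, (lineParam θ p).2) from rfl,
      show (lineParam θ p).1 = ((lineParam θ p).1.1, (lineParam θ p).1.2) from rfl, lineMap_x]
    simp only [lineParam]
    linear_combination p.x * h
  · rw [show lineParam θ p = ((lineParam θ p).1, (lineParam θ p).2) from rfl,
      show (lineParam θ p).1 = ((lineParam θ p).1.1, (lineParam θ p).1.2) from rfl, lineMap_y]
    simp only [lineParam]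
    linear_combination p.y * h
  · rw [show lineParam θ p = ((lineParam θ p).1, (lineParam θ p).2) from rfl,
      show (lineParam θ p).1 = ((lineParam θ p).1.1, (lineParam θ p).1.2) from rfl, lineMap_z]
    simp only [lineParam]
    ring

/-- `Λ_θ : ℝ³ ≃ ℍ`. [cite: CheegerKleinerNaor2011, §4 (arXiv p. 13)] -/
def lineEquiv (θ : ℝ) : (ℝ × ℝ) × ℝ ≃ HeisK where
  toFun := lineMap θ
  invFun := lineParam θ
  left_inv := lineParam_lineMap θ
  right_inv := lineMap_lineParam θ

/-- Distances along a line of the parametrisation: `d_K(Λ_θ((s,w),t), Λ_θ((s,w),t')) = |t − t'|`.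
[cite: CheegerKleinerNaor2011, §2 (arXiv p. 8)] -/
theorem dist_lineMap (θ s w t t' : ℝ) :
    dist (lineMap θ ((s, w), t)) (lineMap θ ((s, w), t')) = |t - t'| :=
  dist_mul_horizontal _ θ t t'

/-- **Left translations permute the horizontal lines of each direction**, acting on the parameters
by a unimodular affine map and on the line parameter by a translation:
`g · Λ_θ((s,w),t) = Λ_θ((s + σ, w + s(g_x cos θ + τ sin²θ) + (g_z − cos θ sin θ τ²/2 + σ τ sin²θ)), τ + t)`
with `τ = g_x cos θ + g_y sin θ`, `σ = −g_x sin θ + g_y cos θ`.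
[cite: CheegerKleinerNaor2011, §4 (arXiv p. 13)] -/
theorem mul_lineMap (g : HeisK) (θ s w t : ℝ) :
    g * lineMap θ ((s, w), t) =
      lineMap θ ((s + (-g.x * Real.sin θ + g.y * Real.cos θ),
        w + s * (g.x * Real.cos θ + (g.x * Real.cos θ + g.y * Real.sin θ) * Real.sin θ ^ 2) +
          (g.z - Real.cos θ * Real.sin θ * (g.x * Real.cos θ + g.y * Real.sin θ) ^ 2 / 2 +
            (-g.x * Real.sin θ + g.y * Real.cos θ) * (g.x * Real.cos θ + g.y * Real.sin θ) *
              Real.sin θ ^ 2)),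
        (g.x * Real.cos θ + g.y * Real.sin θ) + t) := by
  have h := Real.sin_sq_add_cos_sq θ
  ext
  · rw [mul_x, lineMap_x, lineMap_x]
    linear_combination (-g.x) * h
  · rw [mul_y, lineMap_y, lineMap_y]
    linear_combination (-g.y) * h
  · rw [mul_z, lineMap_z, lineMap_z, lineMap_y]
    linear_combination (-(Real.sin θ * t * g.x)) * h

/-- Dilations permute the horizontal lines of each direction: `δ_r Λ_θ((s,w),t) = Λ_θ((rs, r²w), rt)`.
[cite: CheegerKleinerNaor2011, §1.1] -/
theorem dilate_lineMap (r θ s w t : ℝ) :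
    dilate r (lineMap θ ((s, w), t)) = lineMap θ ((r * s, r ^ 2 * w), r * t) := by
  ext
  · rw [dilate_x, lineMap_x, lineMap_x]; ring
  · rw [dilate_y, lineMap_y, lineMap_y]; ring
  · rw [dilate_z, lineMap_z, lineMap_z]; ring

/-! ### Haar measure disintegrates along the horizontal lines of each direction -/

/-- Planar rotations preserve Lebesgue measure (via `ℂ`: multiplication by `e^{iθ}` is a linear
isometry). [folklore] -/
theorem measurePreserving_rotate (θ : ℝ) :
    MeasurePreserving (fun p : ℝ × ℝ =>
      (p.1 * Real.cos θ - p.2 * Real.sin θ, p.1 * Real.sin θ + p.2 * Real.cos θ))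
      (volume : Measure (ℝ × ℝ)) volume := by
  have h1 := Complex.volume_preserving_equiv_real_prod
  have h2 := (rotation (Circle.exp θ)).measurePreserving
  have h := h1.comp (h2.comp h1.symm)
  have e : (fun p : ℝ × ℝ =>
      (p.1 * Real.cos θ - p.2 * Real.sin θ, p.1 * Real.sin θ + p.2 * Real.cos θ)) =
      Complex.measurableEquivRealProd ∘ rotation (Circle.exp θ) ∘
        Complex.measurableEquivRealProd.symm := by
    funext p
    simp only [Function.comp_apply, Complex.measurableEquivRealProd_apply, rotation_apply,
      Circle.coe_exp, Complex.measurableEquivRealProd_symm_apply]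
    rw [Complex.exp_mul_I, Complex.mul_re, Complex.mul_im]
    simp only [Complex.add_re, Complex.add_im, Complex.mul_re, Complex.mul_im, Complex.I_re,
      Complex.I_im, Complex.cos_ofReal_re, Complex.cos_ofReal_im, Complex.sin_ofReal_re,
      Complex.sin_ofReal_im]
    ext <;> ring
  rw [e]
  exact h

/-- The rearrangement `((s,w),t) ↦ ((s,t),w)` preserves Lebesgue measure on `ℝ³`. [folklore] -/
theorem measurePreserving_rearrange :
    MeasurePreserving (fun v : (ℝ × ℝ) × ℝ => ((v.1.1, v.2), v.1.2))
      (volume : Measure ((ℝ × ℝ) × ℝ)) (volume : Measure ((ℝ × ℝ) × ℝ)) := by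
  have h1 : MeasurePreserving (MeasurableEquiv.prodAssoc : (ℝ × ℝ) × ℝ ≃ᵐ ℝ × ℝ × ℝ)
      (volume : Measure ((ℝ × ℝ) × ℝ)) (volume : Measure (ℝ × ℝ × ℝ)) :=
    ⟨MeasurableEquiv.prodAssoc.measurable, Measure.prodAssoc_prod⟩
  have h2 : MeasurePreserving (Prod.map id Prod.swap : ℝ × ℝ × ℝ → ℝ × ℝ × ℝ)
      (volume : Measure (ℝ × ℝ × ℝ)) (volume : Measure (ℝ × ℝ × ℝ)) :=
    (MeasurePreserving.id volume).prod (Measure.measurePreserving_swap (μ := (volume : Measure ℝ))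
      (ν := (volume : Measure ℝ)))
  have h := h1.symm.comp (h2.comp h1)
  have e : (fun v : (ℝ × ℝ) × ℝ => ((v.1.1, v.2), v.1.2)) =
      (MeasurableEquiv.prodAssoc : (ℝ × ℝ) × ℝ ≃ᵐ ℝ × ℝ × ℝ).symm ∘
        (Prod.map id Prod.swap : ℝ × ℝ × ℝ → ℝ × ℝ × ℝ) ∘
          (MeasurableEquiv.prodAssoc : (ℝ × ℝ) × ℝ ≃ᵐ ℝ × ℝ × ℝ) := by
    funext v
    obtain ⟨⟨s, w⟩, t⟩ := v
    simp [MeasurableEquiv.prodAssoc]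
  rw [e]
  exact h

/-- The coordinate expression of `Λ_θ` as a map `ℝ³ → ℝ³` preserves Lebesgue measure: it is a
shear in the third coordinate followed by a planar rotation (Jacobian `1`).
[cite: CheegerKleinerNaor2011, §4 (arXiv p. 13)] -/
theorem measurePreserving_lineCoord (θ : ℝ) :
    MeasurePreserving (fun v : (ℝ × ℝ) × ℝ =>
      (-v.1.1 * Real.sin θ + v.2 * Real.cos θ, v.1.1 * Real.cos θ + v.2 * Real.sin θ,
        v.1.2 + Real.cos θ * Real.sin θ * v.2 ^ 2 / 2 - v.1.1 * v.2 * Real.sin θ ^ 2))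
      (volume : Measure ((ℝ × ℝ) × ℝ)) (volume : Measure (ℝ × ℝ × ℝ)) := by
  -- B : shear `((s,t), w) ↦ ((s,t), w + φ(s,t))`
  have hB : MeasurePreserving (fun v : (ℝ × ℝ) × ℝ =>
      (v.1, v.2 + (Real.cos θ * Real.sin θ * v.1.2 ^ 2 / 2 - v.1.1 * v.1.2 * Real.sin θ ^ 2)))
      (volume : Measure ((ℝ × ℝ) × ℝ)) (volume : Measure ((ℝ × ℝ) × ℝ)) := by
    have := (MeasurePreserving.id (volume : Measure (ℝ × ℝ))).skew_product
      (g := fun st w => w + (Real.cos θ * Real.sin θ * st.2 ^ 2 / 2 - st.1 * st.2 * Real.sin θ ^ 2))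
      (by fun_prop)
      (Filter.Eventually.of_forall fun st => map_add_right_eq_self volume _)
    rw [Measure.volume_eq_prod]
    exact this
  -- C : rotation of the first two coordinates
  have hR : MeasurePreserving (fun p : ℝ × ℝ => (-p.1 * Real.sin θ + p.2 * Real.cos θ,
      p.1 * Real.cos θ + p.2 * Real.sin θ)) (volume : Measure (ℝ × ℝ)) volume := by
    have h := (measurePreserving_rotate θ).comp
      (Measure.measurePreserving_swap (μ := (volume : Measure ℝ)) (ν := (volume : Measure ℝ)))
    rw [Measure.volume_eq_prod]
    have e : (fun p : ℝ × ℝ => (-p.1 * Real.sin θ + p.2 * Real.cos θ,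
        p.1 * Real.cos θ + p.2 * Real.sin θ)) =
        (fun p : ℝ × ℝ => (p.1 * Real.cos θ - p.2 * Real.sin θ,
          p.1 * Real.sin θ + p.2 * Real.cos θ)) ∘ Prod.swap := by
      funext p
      simp only [Function.comp_apply, Prod.fst_swap, Prod.snd_swap, Prod.mk.injEq]
      exact ⟨by ring, by ring⟩
    rw [e]
    exact h
  have hC : MeasurePreserving (Prod.map (fun p : ℝ × ℝ => (-p.1 * Real.sin θ + p.2 * Real.cos θ,
      p.1 * Real.cos θ + p.2 * Real.sin θ)) (id : ℝ → ℝ))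
      (volume : Measure ((ℝ × ℝ) × ℝ)) (volume : Measure ((ℝ × ℝ) × ℝ)) := by
    rw [Measure.volume_eq_prod]
    exact hR.prod (MeasurePreserving.id volume)
  -- D : reassociation
  have hD : MeasurePreserving (MeasurableEquiv.prodAssoc : (ℝ × ℝ) × ℝ ≃ᵐ ℝ × ℝ × ℝ)
      (volume : Measure ((ℝ × ℝ) × ℝ)) (volume : Measure (ℝ × ℝ × ℝ)) :=
    ⟨MeasurableEquiv.prodAssoc.measurable, Measure.prodAssoc_prod⟩
  have h := hD.comp (hC.comp (hB.comp measurePreserving_rearrange))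
  have e : (fun v : (ℝ × ℝ) × ℝ =>
      (-v.1.1 * Real.sin θ + v.2 * Real.cos θ, v.1.1 * Real.cos θ + v.2 * Real.sin θ,
        v.1.2 + Real.cos θ * Real.sin θ * v.2 ^ 2 / 2 - v.1.1 * v.2 * Real.sin θ ^ 2)) =
      (MeasurableEquiv.prodAssoc : (ℝ × ℝ) × ℝ ≃ᵐ ℝ × ℝ × ℝ) ∘
        (Prod.map (fun p : ℝ × ℝ => (-p.1 * Real.sin θ + p.2 * Real.cos θ,
          p.1 * Real.cos θ + p.2 * Real.sin θ)) (id : ℝ → ℝ)) ∘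
        (fun v : (ℝ × ℝ) × ℝ =>
          (v.1, v.2 + (Real.cos θ * Real.sin θ * v.1.2 ^ 2 / 2 - v.1.1 * v.1.2 * Real.sin θ ^ 2))) ∘
        (fun v : (ℝ × ℝ) × ℝ => ((v.1.1, v.2), v.1.2)) := by
    funext v
    obtain ⟨⟨s, w⟩, t⟩ := v
    simp [MeasurableEquiv.prodAssoc, add_sub]
  rw [e]
  exact h

/-- `Λ_θ` in coordinates. [cite: CheegerKleinerNaor2011, §4 (arXiv p. 13)] -/
theorem lineMap_eq_comp (θ : ℝ) :
    lineMap θ = measurableEquivProd.symm ∘ (fun v : (ℝ × ℝ) × ℝ =>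
      (-v.1.1 * Real.sin θ + v.2 * Real.cos θ, v.1.1 * Real.cos θ + v.2 * Real.sin θ,
        v.1.2 + Real.cos θ * Real.sin θ * v.2 ^ 2 / 2 - v.1.1 * v.2 * Real.sin θ ^ 2)) := by
  funext v
  obtain ⟨⟨s, w⟩, t⟩ := v
  ext
  · simp [lineMap_x]
  · simp [lineMap_y]
  · simp [lineMap_z]

/-- **`Λ_θ : ℝ³ → ℍ` is measure preserving** (Lebesgue `ds dw dt` to Haar measure `L₃`): Haar
measure disintegrates along the horizontal lines of any fixed direction, the line parameter `t`
being arc length (`dist_lineMap`). [cite: CheegerKleinerNaor2011, §4 (arXiv p. 13)] -/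
theorem measurePreserving_lineMap (θ : ℝ) :
    MeasurePreserving (lineMap θ) (volume : Measure ((ℝ × ℝ) × ℝ)) (volume : Measure HeisK) := by
  rw [lineMap_eq_comp]
  exact measurePreserving_equivProd_symm.comp (measurePreserving_lineCoord θ)

/-- [cite: CheegerKleinerNaor2011, §4 (arXiv p. 13)] -/
theorem measurable_lineMap (θ : ℝ) : Measurable (lineMap θ) :=
  (measurePreserving_lineMap θ).measurable

/-- **Cavalieri's principle along horizontal lines**: for every direction `θ` and measurable
`E ⊆ ℍ`, `L₃(E) = ∫∫ ℋ¹({t | Λ_θ((s,w),t) ∈ E}) ds dw` — the volume of `E` is the integral over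
the lines of direction `θ` of the length of `E ∩ L` (the `1`-dimensional slices entering the
nonconvexity `NC_{B_r(x)}(E, L)` of [CKN §4] and the kinematic formula of [CKN §6]).
[cite: CheegerKleinerNaor2011, §4 (arXiv p. 13)] -/
theorem volume_eq_lintegral_lines (θ : ℝ) {E : Set HeisK} (hE : MeasurableSet E) :
    volume E = ∫⁻ sw : ℝ × ℝ, volume {t : ℝ | lineMap θ (sw, t) ∈ E} := by
  rw [← (measurePreserving_lineMap θ).measure_preimage hE.nullMeasurableSet,
    Measure.volume_eq_prod, Measure.prod_apply (hE.preimage (measurable_lineMap θ))]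
  rfl

/-! ### Monotone sets and half-spaces -/

/-- The **rays** of the line: `∅`, `ℝ`, and the open or closed half-lines.
[cite: CheegerKleinerNaor2011, §2 (arXiv p. 7)] -/
def IsRay (R : Set ℝ) : Prop :=
  R = ∅ ∨ R = univ ∨ ∃ c : ℝ, R = Iio c ∨ R = Ioi c ∨ R = Iic c ∨ R = Ici c

/-- A subset of the line is **essentially a ray** if it is Lebesgue-a.e. equal to a ray ("up to a
set of measure zero, `E ∩ L` is a sub-ray of the line"). [cite: CheegerKleinerNaor2011, §2 (arXiv p. 7)] -/
def IsEssRay (A : Set ℝ) : Prop := ∃ R : Set ℝ, IsRay R ∧ volume (symmDiff A R) = 0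

/-- [cite: CheegerKleinerNaor2011, §2 (arXiv p. 7)] -/
theorem IsRay.isEssRay {R : Set ℝ} (h : IsRay R) : IsEssRay R := ⟨R, h, by simp⟩

/-- [cite: CheegerKleinerNaor2011, §2 (arXiv p. 7)] -/
theorem isRay_empty : IsRay (∅ : Set ℝ) := Or.inl rfl
/-- [cite: CheegerKleinerNaor2011, §2 (arXiv p. 7)] -/
theorem isRay_univ : IsRay (univ : Set ℝ) := Or.inr (Or.inl rfl)
/-- [cite: CheegerKleinerNaor2011, §2 (arXiv p. 7)] -/
theorem isRay_Iio (c : ℝ) : IsRay (Iio c) := Or.inr (Or.inr ⟨c, Or.inl rfl⟩)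
/-- [cite: CheegerKleinerNaor2011, §2 (arXiv p. 7)] -/
theorem isRay_Ioi (c : ℝ) : IsRay (Ioi c) := Or.inr (Or.inr ⟨c, Or.inr (Or.inl rfl)⟩)
/-- [cite: CheegerKleinerNaor2011, §2 (arXiv p. 7)] -/
theorem isRay_Iic (c : ℝ) : IsRay (Iic c) := Or.inr (Or.inr ⟨c, Or.inr (Or.inr (Or.inl rfl))⟩)
/-- [cite: CheegerKleinerNaor2011, §2 (arXiv p. 7)] -/
theorem isRay_Ici (c : ℝ) : IsRay (Ici c) := Or.inr (Or.inr ⟨c, Or.inr (Or.inr (Or.inr rfl))⟩)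

/-- Complements of rays are rays. [cite: CheegerKleinerNaor2011, §2 (arXiv p. 7)] -/
theorem IsRay.compl {R : Set ℝ} (h : IsRay R) : IsRay Rᶜ := by
  rcases h with rfl | rfl | ⟨c, rfl | rfl | rfl | rfl⟩
  · rw [compl_empty]; exact isRay_univ
  · rw [compl_univ]; exact isRay_empty
  · rw [compl_Iio]; exact isRay_Ici c
  · rw [compl_Ioi]; exact isRay_Iic c
  · rw [compl_Iic]; exact isRay_Ioi c
  · rw [compl_Ici]; exact isRay_Iio c

/-- Complements of essential rays are essential rays. [cite: CheegerKleinerNaor2011, §2 (arXiv p. 7)] -/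
theorem IsEssRay.compl {A : Set ℝ} (h : IsEssRay A) : IsEssRay Aᶜ := by
  obtain ⟨R, hR, h0⟩ := h
  exact ⟨Rᶜ, hR.compl, by rwa [compl_symmDiff_compl]⟩

/-- Sets a.e. equal to an essential ray are essential rays.
[cite: CheegerKleinerNaor2011, §2 (arXiv p. 7)] -/
theorem IsEssRay.congr {A B : Set ℝ} (hA : IsEssRay A) (hAB : volume (symmDiff A B) = 0) :
    IsEssRay B := by
  obtain ⟨R, hR, h0⟩ := hA
  refine ⟨R, hR, nonpos_iff_eq_zero.mp ?_⟩
  calc volume (symmDiff B R) ≤ volume (symmDiff B A ∪ symmDiff A R) :=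
        measure_mono (symmDiff_triangle B A R)
    _ ≤ volume (symmDiff B A) + volume (symmDiff A R) := measure_union_le _ _
    _ = 0 := by rw [symmDiff_comm, hAB, h0, add_zero]

/-- Strict sub-level sets of affine functions are rays. [cite: CheegerKleinerNaor2011, §4 (arXiv p. 14)] -/
theorem isRay_setOf_affine_lt (a b c : ℝ) : IsRay {t : ℝ | a + t * b < c} := by
  rcases lt_trichotomy b 0 with hb | rfl | hb
  · have : {t : ℝ | a + t * b < c} = Ioi ((c - a) / b) := by
      ext t
      rw [mem_setOf_eq, mem_Ioi, div_lt_iff_of_neg hb]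
      constructor <;> intro h <;> linarith
    rw [this]; exact isRay_Ioi _
  · by_cases hac : a < c
    · have : {t : ℝ | a + t * 0 < c} = univ := by
        ext t; simp [hac]
      rw [this]; exact isRay_univ
    · have : {t : ℝ | a + t * 0 < c} = ∅ := by
        ext t; simp only [mul_zero, add_zero, mem_setOf_eq, mem_empty_iff_false, iff_false]; exact hac
      rw [this]; exact isRay_empty
  · have : {t : ℝ | a + t * b < c} = Iio ((c - a) / b) := by
      ext t
      rw [mem_setOf_eq, mem_Iio, lt_div_iff₀ hb]
      constructor <;> intro h <;> linarith
    rw [this]; exact isRay_Iio _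

/-- Non-strict sub-level sets of affine functions are rays. [cite: CheegerKleinerNaor2011, §4 (arXiv p. 14)] -/
theorem isRay_setOf_affine_le (a b c : ℝ) : IsRay {t : ℝ | a + t * b ≤ c} := by
  have h := (isRay_setOf_affine_lt (-a) (-b) (-c)).compl
  have e : {t : ℝ | -a + t * -b < -c}ᶜ = {t : ℝ | a + t * b ≤ c} := by
    ext t
    simp only [mem_compl_iff, mem_setOf_eq, not_lt]
    constructor <;> intro h <;> linarith
  rwa [e] at h

/-- **Monotone sets** ([CKN §2, arXiv p. 7]: "A subset `E ⊂ ℍ` is called monotone if for every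
horizontal line `L`, up to a set of measure zero, `E ∩ L` is a sub-ray of the line"; [CKN §4]:
`NM_{B_r(x)}(E) = 0` "if `E` is monotone", the horizontal lines being taken `𝒩`-a.e.).
Formalised through the parametrisation `Λ_θ((s,w),·)` of the oriented horizontal lines by
`(θ, s, w) ∈ ℝ³` (each line arises, for `θ` modulo `2π`, from exactly one `(s, w)`; the
`𝒩`-null sets of lines are the Lebesgue-null sets of parameters, `mul_lineMap`): `E` is monotone
iff for Lebesgue-a.e. `(θ, s, w)` the set of parameters `{t | Λ_θ((s,w),t) ∈ E}` is essentially a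
ray. [cite: CheegerKleinerNaor2011, §2 (arXiv p. 7)] -/
def IsMonotone (E : Set HeisK) : Prop :=
  ∀ᵐ v : ℝ × (ℝ × ℝ), IsEssRay {t : ℝ | lineMap v.1 (v.2, t) ∈ E}

/-- [cite: CheegerKleinerNaor2011, §2 (arXiv p. 7)] -/
theorem isMonotone_empty : IsMonotone (∅ : Set HeisK) :=
  Filter.Eventually.of_forall fun _ => by simpa using isRay_empty.isEssRay

/-- [cite: CheegerKleinerNaor2011, §2 (arXiv p. 7)] -/
theorem isMonotone_univ : IsMonotone (univ : Set HeisK) :=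
  Filter.Eventually.of_forall fun _ => by simpa using isRay_univ.isEssRay

/-- Complements of monotone sets are monotone (`E'` in [CKN]). [cite: CheegerKleinerNaor2011, §4 (arXiv p. 13)] -/
theorem IsMonotone.compl {E : Set HeisK} (h : IsMonotone E) : IsMonotone Eᶜ := by
  filter_upwards [h] with v hv
  exact hv.compl

/-- The **half-spaces** of `ℍ`: `{α a + β b + γ c < c₀}` in the coordinates `(a,b,c) = (x, y, 2z − xy)`
of [CKN] (including the vertical half-spaces `γ = 0`; for `(α,β,γ) = 0` this is `∅` or `ℍ`).
"monotone subsets are half spaces" [CKN §2, §8]; here the easy direction, `isMonotone_halfspace`.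
[cite: CheegerKleinerNaor2011, §2 (arXiv p. 8)] -/
def halfspace (α β γ c₀ : ℝ) : Set HeisK :=
  {p | α * p.x + β * p.y + γ * (2 * p.z - p.x * p.y) < c₀}

/-- Membership of a point of a horizontal line in a half-space is an affine condition on the line
parameter. [cite: CheegerKleinerNaor2011, §4 (arXiv p. 14)] -/
theorem lineMap_mem_halfspace_iff (α β γ c₀ θ s w t : ℝ) :
    lineMap θ ((s, w), t) ∈ halfspace α β γ c₀ ↔
      (α * (-s * Real.sin θ) + β * (s * Real.cos θ) + γ * (2 * w + s ^ 2 * Real.sin θ * Real.cos θ)) +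
        t * (α * Real.cos θ + β * Real.sin θ - γ * s) < c₀ := by
  have h := ckn_lineMap θ s w t
  simp only [ckn, Prod.mk.injEq] at h
  obtain ⟨hx, hy, hc⟩ := h
  simp only [halfspace, mem_setOf_eq]
  rw [hc, hx, hy]
  constructor <;> intro h' <;> linarith

/-- **Half-spaces are monotone** — indeed every horizontal line meets a half-space in a ray (no
exceptional null set): the easy direction of the classification of monotone sets [CKN §8].
[cite: CheegerKleinerNaor2011, §2 (arXiv p. 8)] -/
theorem isRay_halfspace_slice (α β γ c₀ θ s w : ℝ) :
    IsRay {t : ℝ | lineMap θ ((s, w), t) ∈ halfspace α β γ c₀} := by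
  have e : {t : ℝ | lineMap θ ((s, w), t) ∈ halfspace α β γ c₀} =
      {t : ℝ | (α * (-s * Real.sin θ) + β * (s * Real.cos θ) +
        γ * (2 * w + s ^ 2 * Real.sin θ * Real.cos θ)) +
          t * (α * Real.cos θ + β * Real.sin θ - γ * s) < c₀} := by
    ext t
    exact lineMap_mem_halfspace_iff α β γ c₀ θ s w t
  rw [e]
  exact isRay_setOf_affine_lt _ _ _

/-- [cite: CheegerKleinerNaor2011, §2 (arXiv p. 8)] -/
theorem isMonotone_halfspace (α β γ c₀ : ℝ) : IsMonotone (halfspace α β γ c₀) :=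
  Filter.Eventually.of_forall fun v => (isRay_halfspace_slice α β γ c₀ v.1 v.2.1 v.2.2).isEssRay

/-- Closed half-spaces (complements of open ones) are monotone. [cite: CheegerKleinerNaor2011, §2 (arXiv p. 8)] -/
theorem isMonotone_halfspace_compl (α β γ c₀ : ℝ) : IsMonotone (halfspace α β γ c₀)ᶜ :=
  (isMonotone_halfspace α β γ c₀).compl

/-- Half-spaces are open. [cite: CheegerKleinerNaor2011, §2 (arXiv p. 8)] -/
theorem isOpen_halfspace (α β γ c₀ : ℝ) : IsOpen (halfspace α β γ c₀) := by
  have hc : Continuous fun p : HeisK => α * p.x + β * p.y + γ * (2 * p.z - p.x * p.y) := by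
    have hx := lipschitzWith_x.continuous
    have hy := lipschitzWith_y.continuous
    have hz := continuous_z
    fun_prop
  exact isOpen_lt hc continuous_const

/-- Half-spaces are measurable. [cite: CheegerKleinerNaor2011, §2 (arXiv p. 8)] -/
theorem measurableSet_halfspace (α β γ c₀ : ℝ) : MeasurableSet (halfspace α β γ c₀) :=
  (isOpen_halfspace α β γ c₀).measurableSet

/-- Left translates of half-spaces are half-spaces (the family is `ℍ`-invariant).
[cite: CheegerKleinerNaor2011, §2 (arXiv p. 8)] -/
theorem preimage_mul_halfspace (g : HeisK) (α β γ c₀ : ℝ) :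
    (fun p => g * p) ⁻¹' halfspace α β γ c₀ =
      halfspace (α - γ * g.y) (β + γ * g.x) γ (c₀ - (α * g.x + β * g.y + γ * (2 * g.z - g.x * g.y))) := by
  ext p
  simp only [mem_preimage, halfspace, mem_setOf_eq, mul_x, mul_y, mul_z]
  constructor <;> intro h <;> nlinarith [h]

/-- Dilates of half-spaces are half-spaces. [cite: CheegerKleinerNaor2011, §2 (arXiv p. 8)] -/
theorem preimage_dilate_halfspace (r α β γ c₀ : ℝ) :
    dilate r ⁻¹' halfspace α β γ c₀ = halfspace (r * α) (r * β) (r ^ 2 * γ) c₀ := by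
  ext p
  simp only [mem_preimage, halfspace, mem_setOf_eq, dilate_x, dilate_y, dilate_z]
  constructor <;> intro h <;> nlinarith [h]

/-! ### Invariance of monotonicity under left translations and dilations -/

/-- Preimages commute with symmetric differences. [folklore] -/
theorem preimage_symmDiff' {X Y : Type*} (f : X → Y) (A B : Set Y) :
    f ⁻¹' (symmDiff A B) = symmDiff (f ⁻¹' A) (f ⁻¹' B) := by
  ext x
  simp [Set.mem_symmDiff]

/-- Rays are translation invariant. [cite: CheegerKleinerNaor2011, §2 (arXiv p. 7)] -/
theorem IsRay.preimage_const_add {R : Set ℝ} (h : IsRay R) (τ : ℝ) :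
    IsRay ((fun t => τ + t) ⁻¹' R) := by
  rcases h with rfl | rfl | ⟨c, rfl | rfl | rfl | rfl⟩
  · exact isRay_empty
  · exact isRay_univ
  · rw [Set.preimage_const_add_Iio]; exact isRay_Iio _
  · rw [Set.preimage_const_add_Ioi]; exact isRay_Ioi _
  · rw [Set.preimage_const_add_Iic]; exact isRay_Iic _
  · rw [Set.preimage_const_add_Ici]; exact isRay_Ici _

/-- Essential rays are translation invariant. [cite: CheegerKleinerNaor2011, §2 (arXiv p. 7)] -/
theorem IsEssRay.preimage_const_add {A : Set ℝ} (h : IsEssRay A) (τ : ℝ) :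
    IsEssRay ((fun t => τ + t) ⁻¹' A) := by
  obtain ⟨R, hR, h0⟩ := h
  refine ⟨(fun t => τ + t) ⁻¹' R, hR.preimage_const_add τ, ?_⟩
  rw [← preimage_symmDiff', measure_preimage_add]
  exact h0

/-- Rays are invariant under non-zero scalings. [cite: CheegerKleinerNaor2011, §1.1] -/
theorem IsRay.preimage_const_mul {R : Set ℝ} (h : IsRay R) {r : ℝ} (hr : r ≠ 0) :
    IsRay ((fun t => r * t) ⁻¹' R) := by
  rcases lt_or_gt_of_ne hr with hr | hr
  · rcases h with rfl | rfl | ⟨c, rfl | rfl | rfl | rfl⟩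
    · exact isRay_empty
    · exact isRay_univ
    · rw [Set.preimage_const_mul_Iio_of_neg _ hr]; exact isRay_Ioi _
    · rw [Set.preimage_const_mul_Ioi_of_neg _ hr]; exact isRay_Iio _
    · rw [Set.preimage_const_mul_Iic_of_neg _ hr]; exact isRay_Ici _
    · rw [Set.preimage_const_mul_Ici_of_neg _ hr]; exact isRay_Iic _
  · rcases h with rfl | rfl | ⟨c, rfl | rfl | rfl | rfl⟩
    · exact isRay_empty
    · exact isRay_univ
    · rw [Set.preimage_const_mul_Iio₀ _ hr]; exact isRay_Iio _
    · rw [Set.preimage_const_mul_Ioi₀ _ hr]; exact isRay_Ioi _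
    · rw [Set.preimage_const_mul_Iic₀ _ hr]; exact isRay_Iic _
    · rw [Set.preimage_const_mul_Ici₀ _ hr]; exact isRay_Ici _

/-- Essential rays are invariant under non-zero scalings. [cite: CheegerKleinerNaor2011, §1.1] -/
theorem IsEssRay.preimage_const_mul {A : Set ℝ} (h : IsEssRay A) {r : ℝ} (hr : r ≠ 0) :
    IsEssRay ((fun t => r * t) ⁻¹' A) := by
  obtain ⟨R, hR, h0⟩ := h
  refine ⟨(fun t => r * t) ⁻¹' R, hR.preimage_const_mul hr, ?_⟩
  rw [← preimage_symmDiff', Real.volume_preimage_mul_left hr, h0, mul_zero]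

/-- The action of the left translation by `g` on the parameters `(θ, s, w)` of horizontal lines
(cf. `mul_lineMap`) preserves Lebesgue measure: **the measure `dθ ds dw` on lines is
left-invariant** (the measure `𝒩` of [CKN §4]). [cite: CheegerKleinerNaor2011, §4 (arXiv p. 13)] -/
theorem measurePreserving_lineParamShift (g : HeisK) :
    MeasurePreserving (fun v : ℝ × (ℝ × ℝ) => (v.1,
      (v.2.1 + (-g.x * Real.sin v.1 + g.y * Real.cos v.1),
        v.2.2 + v.2.1 * (g.x * Real.cos v.1 +
          (g.x * Real.cos v.1 + g.y * Real.sin v.1) * Real.sin v.1 ^ 2) +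
          (g.z - Real.cos v.1 * Real.sin v.1 * (g.x * Real.cos v.1 + g.y * Real.sin v.1) ^ 2 / 2 +
            (-g.x * Real.sin v.1 + g.y * Real.cos v.1) * (g.x * Real.cos v.1 + g.y * Real.sin v.1) *
              Real.sin v.1 ^ 2))))
      (volume : Measure (ℝ × (ℝ × ℝ))) volume := by
  -- for each `θ`, the map of `(s, w)` is a shear followed by a translation
  have hθ : ∀ (σ k m : ℝ), Measure.map (fun sw : ℝ × ℝ => (sw.1 + σ, sw.2 + sw.1 * k + m))
      (volume : Measure (ℝ × ℝ)) = volume := by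
    intro σ k m
    have h1 : MeasurePreserving (fun sw : ℝ × ℝ => (sw.1, sw.2 + sw.1 * k + m))
        (volume : Measure (ℝ × ℝ)) volume := by
      have := (MeasurePreserving.id (volume : Measure ℝ)).skew_product
        (g := fun a b => b + a * k + m) (by fun_prop)
        (Filter.Eventually.of_forall fun a => by
          have := map_add_right_eq_self (volume : Measure ℝ) (a * k + m)
          simp only [add_assoc]
          exact this)
      rw [Measure.volume_eq_prod]
      exact this
    have h2 : MeasurePreserving (fun sw : ℝ × ℝ => (sw.1 + σ, sw.2))
        (volume : Measure (ℝ × ℝ)) volume := by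
      have := (measurePreserving_add_right (volume : Measure ℝ) σ).prod
        (MeasurePreserving.id (volume : Measure ℝ))
      rw [Measure.volume_eq_prod]
      exact this
    have h := h2.comp h1
    exact h.map_eq
  have := (MeasurePreserving.id (volume : Measure ℝ)).skew_product
    (g := fun θ (sw : ℝ × ℝ) => (sw.1 + (-g.x * Real.sin θ + g.y * Real.cos θ),
        sw.2 + sw.1 * (g.x * Real.cos θ + (g.x * Real.cos θ + g.y * Real.sin θ) * Real.sin θ ^ 2) +
          (g.z - Real.cos θ * Real.sin θ * (g.x * Real.cos θ + g.y * Real.sin θ) ^ 2 / 2 +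
            (-g.x * Real.sin θ + g.y * Real.cos θ) * (g.x * Real.cos θ + g.y * Real.sin θ) *
              Real.sin θ ^ 2)))
    (by fun_prop) (Filter.Eventually.of_forall fun θ => hθ _ _ _)
  rw [Measure.volume_eq_prod]
  exact this

/-- **Monotonicity is left-invariant**: left translates of monotone sets are monotone.
[cite: CheegerKleinerNaor2011, §4 (arXiv p. 13)] -/
theorem IsMonotone.preimage_mul_left {E : Set HeisK} (h : IsMonotone E) (g : HeisK) :
    IsMonotone ((fun p => g * p) ⁻¹' E) := by
  have h' := (measurePreserving_lineParamShift g).quasiMeasurePreserving.ae h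
  unfold IsMonotone
  filter_upwards [h'] with v hv
  obtain ⟨θ, s, w⟩ := v
  have e : {t : ℝ | lineMap θ ((s, w), t) ∈ (fun p => g * p) ⁻¹' E} =
      (fun t => (g.x * Real.cos θ + g.y * Real.sin θ) + t) ⁻¹'
        {t : ℝ | lineMap θ ((s + (-g.x * Real.sin θ + g.y * Real.cos θ),
          w + s * (g.x * Real.cos θ + (g.x * Real.cos θ + g.y * Real.sin θ) * Real.sin θ ^ 2) +
            (g.z - Real.cos θ * Real.sin θ * (g.x * Real.cos θ + g.y * Real.sin θ) ^ 2 / 2 +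
              (-g.x * Real.sin θ + g.y * Real.cos θ) * (g.x * Real.cos θ + g.y * Real.sin θ) *
                Real.sin θ ^ 2)), t) ∈ E} := by
    ext t
    simp only [mem_setOf_eq, mem_preimage]
    rw [mul_lineMap]
  rw [e]
  exact hv.preimage_const_add _

/-- The action `(θ, s, w) ↦ (θ, rs, r²w)` of the dilation `δ_r` (`r ≠ 0`) on the parameters of
horizontal lines (cf. `dilate_lineMap`) is non-singular for Lebesgue measure.
[cite: CheegerKleinerNaor2011, §1.1] -/
theorem quasiMeasurePreserving_lineParamDilate {r : ℝ} (hr : r ≠ 0) :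
    Measure.QuasiMeasurePreserving (fun v : ℝ × (ℝ × ℝ) => (v.1, (r * v.2.1, r ^ 2 * v.2.2)))
      (volume : Measure (ℝ × (ℝ × ℝ))) volume := by
  have hr2 : r ^ 2 ≠ 0 := pow_ne_zero 2 hr
  have h1 : MeasurePreserving (fun a : ℝ => r * a) volume (ENNReal.ofReal |r⁻¹| • volume) :=
    ⟨measurable_const_mul r, Real.map_volume_mul_left hr⟩
  have h2 : MeasurePreserving (fun a : ℝ => r ^ 2 * a) volume
      (ENNReal.ofReal |(r ^ 2)⁻¹| • volume) :=
    ⟨measurable_const_mul _, Real.map_volume_mul_left hr2⟩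
  have h12 := h1.prod h2
  have h := (MeasurePreserving.id (volume : Measure ℝ)).prod h12
  refine ⟨by fun_prop, ?_⟩
  rw [Measure.volume_eq_prod, Measure.volume_eq_prod]
  have e : (fun v : ℝ × (ℝ × ℝ) => (v.1, (r * v.2.1, r ^ 2 * v.2.2))) =
      Prod.map id (Prod.map (fun a : ℝ => r * a) (fun a : ℝ => r ^ 2 * a)) := rfl
  rw [e, h.map_eq, Measure.prod_smul_left, Measure.prod_smul_right, Measure.prod_smul_right,
    Measure.prod_smul_right]
  exact Measure.smul_absolutelyContinuous.trans Measure.smul_absolutelyContinuous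

/-- **Monotonicity is dilation-invariant**: preimages of monotone sets under `δ_r`, `r ≠ 0`, are
monotone. [cite: CheegerKleinerNaor2011, §1.1] -/
theorem IsMonotone.preimage_dilate {E : Set HeisK} (h : IsMonotone E) {r : ℝ} (hr : r ≠ 0) :
    IsMonotone (dilate r ⁻¹' E) := by
  have h' := (quasiMeasurePreserving_lineParamDilate hr).ae h
  unfold IsMonotone
  filter_upwards [h'] with v hv
  obtain ⟨θ, s, w⟩ := v
  have e : {t : ℝ | lineMap θ ((s, w), t) ∈ dilate r ⁻¹' E} =
      (fun t => r * t) ⁻¹' {t : ℝ | lineMap θ ((r * s, r ^ 2 * w), t) ∈ E} := by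
    ext t
    simp only [mem_setOf_eq, mem_preimage]
    rw [dilate_lineMap]
  rw [e]
  exact hv.preimage_const_mul hr

end HeisK

end Literature.Geometry.MetricEmbeddings

end
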